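/-
Copyright: cell `pub-ymgap` (HUMAN RULING D-0062), Track A of `YM-PLAN.md`, DAG node N20 (= NE7b); R134 acceleration seat
`pub-ymgap-dag-n20-c` (strategy s1, generation 5), module 28.  Released under the licence of the surrounding project.
-/
import Summits.QuantumFields.YangMills.Theorems.BalabanUVNodesN20LCSLabelTower
import Summits.QuantumFields.YangMills.Theorems.BalabanUVNodesN20LCSLargeFieldClassWeight
import Summits.QuantumFields.YangMills.Theorems.BalabanUVNodesN20LCSLargeFieldSparsify
import HarnessLib

/-!
# YM-DAG node N20 (= NE7b), strategy s1, module 28: THE (α)-ROAD's CLASS WEIGHT BOUND ON THE CONCRETE LABEL TOWER OF RECORD — module 25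
# (`sum_admS_integral_le_of_record_rootedAtZero`) with ALL ITS TOWER ROWS DISCHARGED (`hread`, `hstep`, `hintχ`, `hint`, `hρ₀`, `μ 0 = Haar`, and
# the positivity binder `0 ≤ ζ`): for keys rooted at the first step, ONE PEIERLS FACTOR PER PINNED CUBE, modulo only the two ζ-laws, the (O4)
# measurability of the label weights and the per-cube regularity letters

Track A of `YM-PLAN.md` (cell `pub-ymgap`, HUMAN RULING D-0062), node **N20** = spine estimate NE7b (`T4WeightBudget.RelWeightBound` — NOT PRINTED,
NOT PROVED).  Seat `pub-ymgap-dag-n20-c` (R134, s1 «the `LocCondStability` INSTANCE for Bałaban's tower at a pinned 𝐑𝐓 step»), generation 5, module 28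
(after module 27 `…N20LCSLabelTower` = the label tower of record; g4's modules 17–26).  Kernel theorems only: 0 `def`, 0 `sorry`, standard axioms;
COUNT-NEUTRAL; `--supports` the K3‴ item.  Nothing of Bałaban's is asserted.

WHAT.
* §1 UNDER THE TWO DISPLAYED ζ-LAWS (`IsZetaUnity`, `IsZetaAbsLeOne` of `Node00.StepWeightsOfRecord`): `clampW_ωOfRecord` (the clamp in module 27's
  kernels is the identity: `0 ≤ ω ≤ 1` by n21-d's positivity + module 21's `abs_ωOfRecord_le_one`), `labelChi_eq` (the step kernel of the label tower
  IS the label weight read on the graph, `labelChi j h q U = ω (seqOfHist j h) (labelAt j q) (U, Ū)`), ★ **`hread_labelTower`** (the label tower READS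
  LABEL SUB-SUMS: for every label family `E`, `Σ_{q ∈ branch j h ∩ labelPattern E j h} labelChi j h q U = Σ_{t ∈ E j h} ω (seqOfHist j h) t (U, Ū)` —
  module 25's `hread` by `rfl` up to the clamp), ★ **`hunit_labelTower`** (IR-102-1's decomposition of unity `Σ_{q ∈ branch j h} labelChi j h q U = 1`,
  module 21's `sum_ωOfRecord_eq_one`), ★ **`hpres_labelTower`** (mass preservation of the label T-step in the tower's currency:
  `Σ_{q ∈ branch j h} ∫ (op j h q).T f dμ_{j+1} = ∫ f dμ_j` for every bounded measurable `f`, from module 27's `hstep_labelTower` + `hunit`).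
* §2 ★★★ **`sum_admS_integral_le_labelTower_rootedAtZero`** — THE CLASS WEIGHT BOUND FIRES ON THE CONCRETE TOWER.  With the `δ₀ > 0`, `C ≥ 0` of n20-d's
  cells Peierls bound: on every torus `F.P K` (`K ≥ 1`), for `g₀⁻² ≥ 4N`, every `E₀`, `A₁`, every residual fluctuation factor `ζ` obeying `IsZetaUnity`
  and `IsZetaAbsLeOne` WITH (O4)-measurable label weights, every finite family `D` of χ₁-cubes with regularity letters ([Balaban1985Variational] Thm 1
  p. 279 shape, displayed) on pairwise disjoint regions of at most `m ≥ 1` plaquettes and `ε″ ≥ 0`; for every cutoff `Kc + 1` and EVERY label-family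
  pattern `E` pinning `D` into the first label's new large-field family (`∀ h t, t ∈ E 0 h → D ⊆ t.1`; arbitrary label constraints at later levels):
  `Σ_{h ∈ admS (labelTowerOfRecord A₁ ζ) (labelPattern E) (Kc+1)} ∫ eterm ρ₀ (Kc+1) h dμ_{Kc+1} ≤ (m·e^{Cδ₀ − δ₀g₀⁻²ε″²∕(2N)})^{#D} · ∫ ρ₀ dU`
  against the Haar field at level `0` — END2's `extractA` SHAPE («the class is at most `q` times the whole», `q = (m r)^{#D}`: ONE PEIERLS FACTOR PER
  PINNED CUBE) for the histories of BAŁABAN's LABEL TOWER whose first label pins `D` large.  The abstract-tower binders of module 25 are ALL GONE: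
  `T`, `𝒢`, `μ`, `χ`, `sq` are module 27's objects, `hread`∕`hstep`∕`hintχ`∕`hint`∕`hρ₀`∕`μ 0 = Haar`∕`sq 0 = s` its theorems, `0 ≤ ζ` module 26's
  `zeta_nonneg_of_laws`.
* §3 `halves_labelTower_rootedAtZero` — the two NAMED `Prop`s of the (α)-road, `PointwiseExtraction ∧ LocCondStability`, JOINTLY INHABITED ON THE
  CONCRETE TOWER at every cutoff for keys rooted at the first step (module 24 at module 27's objects; same residual binders as §2).
* §4 (v1.1, append-only) `sum_admS_integral_le_labelTower_rootedAtZero_of_overlap` — OVERLAPPING LETTER REGIONS: if every region `R □` meets at most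
  `K₀ ≥ 1` regions of the family (itself included), module 26's greedy sparsification (`exists_disjoint_subfamily`) gives a pairwise-disjoint sub-family
  `D′ ⊆ D` with `#D ≤ K₀·#D′`, and §2 applied to `D′` (a pattern pinning `D` pins `D′`) gives the class bound with the exponent `#D′ ≥ #D∕K₀` — the
  disjointness caveat of §2 removed at the price `K₀` in the exponent.

HONEST FRAMING.  A by-name CLOSURE of the (α)-road's Peierls bookkeeping ON AN OBJECT OF BAŁABAN's (the T-steps of record with label-indexed choices,
conditional-expectation currency — module 27's honest framing applies: densities w.r.t. the laws of the iterated averages, same integrals as the Haar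
currency; the 𝐑-step ∕ (A1c) is NOT in this tower), for ONE kind of key (rooted at step 0, the (3.2) event; free later levels), CONDITIONAL on exactly:
the two ζ-laws (def-T's residual `ζ` — the (3.10) minimiser has no body), the (O4) joint measurability of the label weights (def-R's (2.12) minimiser has
no measurable selection), the per-cube regularity letters ([Balaban1985Variational] Thm 1, NOT asserted; inhabited in the degenerate threshold regime by
module 24 §3), pairwise disjoint letter regions in §2–§3 (§4, v1.1: bounded overlap `K₀` at the price `K₀` in the exponent).  Keys rooted at `j₀ ≥ 1`: «LCS-j₀» in the dressed state ((A1c);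
module 22's `hLS`).  NE7b NOT PRINTED ∕ NOT PROVED; (α)-instance 0∕1; N20 NOT discharged; typed 28∕28, discharged count untouched; one finite four-torus
at fixed `ε` — NOT ℝ⁴, NOT infinite volume, NOT OS, NOT a mass gap, NOT Clay.

References (LOCATORS): T. Bałaban, CMP 119 (1988) 243–285 [Balaban1988Convergent] ((3.2)–(3.5) p. 265, (3.16) p. 268, (3.20)–(3.21) p. 269); CMP 122
(1989) 175–202 [Balaban1989LargeFieldI] ((0.1) p. 175, (1.22)–(1.28) pp. 181–183); CMP 122 (1989) 355–392 [Balaban1989LargeFieldII] ((1.79)–(1.80)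
pp. 383–384); CMP 102 (1985) 277–309 [Balaban1985Variational] (Thm 1 p. 279).
-/

set_option autoImplicit false

noncomputable section

open scoped BigOperators

namespace Summit.QuantumFields.YangMills.BalabanUVNodes.N20LCSLabelTowerClassWeight

open MeasureTheory
open Literature.MathematicalPhysics.QuantumFieldTheory.Balaban1983to89
open Literature.MathematicalPhysics.QuantumFieldTheory.Balaban1983to89.T4Continuum
open Literature.MathematicalPhysics.QuantumFieldTheory.Balaban1983to89.B14.Eq218Concrete
open Literature.MathematicalPhysics.QuantumFieldTheory.Balaban1983to89.Node00
open Summit.QuantumFields.BalabanUV.T4Continuum.B16HistoryIndexedRepr (GoodClass)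
open Summit.QuantumFields.BalabanUV.T4Continuum.B16HistoryReprChain
open Summit.QuantumFields.BalabanUV.T4Continuum.NE7b.PrefixExtraction (admS)
open Summit.QuantumFields.BalabanUV.T4Continuum.NE7b.LocalConditionalStability (LocCondStability PointwiseExtraction)
open Summit.QuantumFields.YangMills.BalabanUVNodes.N20LCSLabelTower
open Summit.QuantumFields.YangMills.BalabanUVNodes.N20LCSLabelPieces (abs_ωOfRecord_le_one sum_ωOfRecord_eq_one)
open Summit.QuantumFields.YangMills.BalabanUVNodes.N20LCSLargeFieldSubfamilies (ωOfRecord_nonneg)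
open Summit.QuantumFields.YangMills.BalabanUVNodes.N20LCSLargeFieldSparsify (zeta_nonneg_of_laws)
open Summit.QuantumFields.YangMills.BalabanUVNodes.N20LCSLargeFieldRootedAtZero (halves_of_record_rootedAtZero)
open Summit.QuantumFields.YangMills.BalabanUVNodes.N20LCSLargeFieldClassWeight (sum_admS_integral_le_of_record_rootedAtZero)

variable (F : T4Family) (N : ℕ) [NeZero N] (ν : Stage7Numerics) (M : ℕ) (p : B12.RunParams) (g : ℕ → ℝ)

/-! ## §1 Under the two ζ-laws: the clamp is the identity, `hread`, `hunit`, `hpres` -/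

section Laws

variable {A₁ : ℝ} {ζ : ZetaOfRecord F N ν M}

/-- Under `IsZetaUnity ∧ IsZetaAbsLeOne` every label weight of record lies in `[0,1]`, so module 27's clamp is the identity on it. [folklore] -/
theorem clampW_ωOfRecord (A₁ : ℝ) (hζu : IsZetaUnity F N ν M ζ) (hζ : IsZetaAbsLeOne F N ν M ζ) (k : ℕ) (s : SeqOfRecord F ν M g p.K k)
    (t : LbOfRecord F ν p g k) (U : cfgOfRecord F N p.K k) (V' : cfgOfRecord F N p.K (k + 1)) :
    clampW (ωOfRecord F N ν M p g k A₁ ζ s t U V') = ωOfRecord F N ν M p g k A₁ ζ s t U V' :=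
  clampW_eq_self (ωOfRecord_nonneg F N ν M p g k A₁ (zeta_nonneg_of_laws F N ν M hζu hζ) s t U V')
    ((le_abs_self _).trans (abs_ωOfRecord_le_one F N ν M p g k A₁ hζ s t U V'))

/-- **THE STEP KERNEL IS THE LABEL WEIGHT ON THE GRAPH** (under the two ζ-laws): `labelChi j h q U = ω (seqOfHist j h) (labelAt j q) (U, Ū)`. [folklore] -/
theorem labelChi_eq (A₁ : ℝ) (hζu : IsZetaUnity F N ν M ζ) (hζ : IsZetaAbsLeOne F N ν M ζ) (j : ℕ) (h : Fin j → LabelPat F ν p g)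
    (q : LabelPat F ν p g) (U : cfgOfRecord F N p.K j) :
    labelChi F N ν M p g A₁ ζ j h q U =
      ωOfRecord F N ν M p g j A₁ ζ (seqOfHist F ν M p g j h) (labelAt F ν p g j q) U ((avOfRecord F N p.K j).avg U) :=
  clampW_ωOfRecord F N ν M p g A₁ hζu hζ j _ _ U _

/-- ★ **`hread` FOR THE LABEL TOWER** (module 25's identification binder, here a theorem): under the two ζ-laws, for every label family `E`, the step
kernels of the choices pinned by `labelPattern E` after the history `h` at level `j` sum to the label sub-sum of the record over `E j h` along the old
sequence of `h`. [folklore] -/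
theorem hread_labelTower [DecidableEq (LabelPat F ν p g)] (A₁ : ℝ) (hζu : IsZetaUnity F N ν M ζ) (hζ : IsZetaAbsLeOne F N ν M ζ)
    (E : (j : ℕ) → (Fin j → LabelPat F ν p g) → Finset (LbOfRecord F ν p g j)) (j : ℕ) (h : Fin j → LabelPat F ν p g)
    (U : cfgOfRecord F N p.K j) :
    ∑ q ∈ (labelTowerOfRecord F N ν M p g A₁ ζ).branch j h ∩ labelPattern F ν p g E j h, labelChi F N ν M p g A₁ ζ j h q U =
      ∑ t ∈ E j h, ωOfRecord F N ν M p g j A₁ ζ (seqOfHist F ν M p g j h) t U ((avOfRecord F N p.K j).avg U) := by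
  rw [branch_inter_labelPattern, sum_labelPattern]
  exact Finset.sum_congr rfl fun t _ => by rw [labelChi_eq F N ν M p g A₁ hζu hζ, labelAt_mk]

/-- ★ **`hunit` FOR THE LABEL TOWER** (IR-102-1's decomposition of unity; π-ne7bref-g63-4's letter): under the two ζ-laws the step kernels of ALL labels
after any history sum to one pointwise (module 21's `sum_ωOfRecord_eq_one`). [folklore] -/
theorem hunit_labelTower (A₁ : ℝ) (hζu : IsZetaUnity F N ν M ζ) (hζ : IsZetaAbsLeOne F N ν M ζ) (j : ℕ) (h : Fin j → LabelPat F ν p g)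
    (U : cfgOfRecord F N p.K j) :
    ∑ q ∈ (labelTowerOfRecord F N ν M p g A₁ ζ).branch j h, labelChi F N ν M p g A₁ ζ j h q U = 1 := by
  rw [sum_branch, Finset.sum_congr rfl fun t _ => by rw [labelChi_eq F N ν M p g A₁ hζu hζ, labelAt_mk]]
  exact sum_ωOfRecord_eq_one F N ν M p g j A₁ hζu _ U _

/-- ★ **`hpres` FOR THE LABEL TOWER** (mass preservation, the unpinned-level row of `PrefixExtraction.hrel_one_of_hpres` and of
`B16HistoryTowerExtractionStepDataLWR`): under the two ζ-laws and the (O4) measurability, for every bounded measurable `f` of level `j`, the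
level-`(j+1)` integrals of its images under ALL label operations after `h` add up to its level-`j` integral. [folklore] -/
theorem hpres_labelTower (A₁ : ℝ) (hζu : IsZetaUnity F N ν M ζ) (hζ : IsZetaAbsLeOne F N ν M ζ)
    (hω : ∀ (k : ℕ) (s : SeqOfRecord F ν M g p.K k) (t : LbOfRecord F ν p g k),
      Measurable fun z : cfgOfRecord F N p.K (k + 1) × cfgOfRecord F N p.K k => ωOfRecord F N ν M p g k A₁ ζ s t z.2 z.1)
    (j : ℕ) (h : Fin j → LabelPat F ν p g) (f : cfgOfRecord F N p.K j → ℝ) (hf : (bddMeas (cfgOfRecord F N p.K j)).Gd f) :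
    ∑ q ∈ (labelTowerOfRecord F N ν M p g A₁ ζ).branch j h,
        ∫ V', ((labelTowerOfRecord F N ν M p g A₁ ζ).op j h q).T f V' ∂(lawOfRecord F N p.K (j + 1)) =
      ∫ U, f U ∂(lawOfRecord F N p.K j) := by
  have hint : ∀ q, Integrable (fun U => labelChi F N ν M p g A₁ ζ j h q U * f U) (lawOfRecord F N p.K j) := fun q =>
    integrable_of_bddMeas _ ((bddMeas _).mul (labelChi_good F N ν M p g hω j h q) hf)
  rw [Finset.sum_congr rfl fun q _ => hstep_labelTower F N ν M p g hω j h q f hf, ← integral_finsetSum _ fun q _ => hint q]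
  refine integral_congr_ae (ae_of_all _ fun U => ?_)
  show ∑ q ∈ (labelTowerOfRecord F N ν M p g A₁ ζ).branch j h, labelChi F N ν M p g A₁ ζ j h q U * f U = f U
  rw [← Finset.sum_mul, hunit_labelTower F N ν M p g A₁ hζu hζ, one_mul]

/-- `hpres` in the END's binder shape (`B16HistoryReprInstance.integral_dens_eq_of_lt`, `PrefixExtraction.sum_admS_integral_le_mul_sum_adm`: the integral
of the SUM of the images) for the history terms of a bounded measurable `ρ₀`. [folklore] -/
theorem hpres_labelTower_eterm (A₁ : ℝ) (hζu : IsZetaUnity F N ν M ζ) (hζ : IsZetaAbsLeOne F N ν M ζ)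
    (hω : ∀ (k : ℕ) (s : SeqOfRecord F ν M g p.K k) (t : LbOfRecord F ν p g k),
      Measurable fun z : cfgOfRecord F N p.K (k + 1) × cfgOfRecord F N p.K k => ωOfRecord F N ν M p g k A₁ ζ s t z.2 z.1)
    {ρ₀ : cfgOfRecord F N p.K 0 → ℝ} (hρ : (bddMeas (cfgOfRecord F N p.K 0)).Gd ρ₀) (j : ℕ) (h : Fin j → LabelPat F ν p g) :
    ∫ V', (∑ q ∈ (labelTowerOfRecord F N ν M p g A₁ ζ).branch j h, ((labelTowerOfRecord F N ν M p g A₁ ζ).op j h q).T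
        ((labelTowerOfRecord F N ν M p g A₁ ζ).eterm ρ₀ j h) V') ∂(lawOfRecord F N p.K (j + 1)) =
      ∫ U, (labelTowerOfRecord F N ν M p g A₁ ζ).eterm ρ₀ j h U ∂(lawOfRecord F N p.K j) := by
  rw [integral_finsetSum _ fun q _ => integrable_op_eterm F N ν M p g hρ j h q]
  exact hpres_labelTower F N ν M p g A₁ hζu hζ hω j h _ ((labelTowerOfRecord F N ν M p g A₁ ζ).eterm_good hρ j h)

/-- **THE TOTAL MASS IS PRESERVED ALONG THE LABEL TOWER** (the `H2A`-type telescoping, `Tower.integral_dens_eq_of_lt`): under the two ζ-laws and the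
(O4) measurability, for every bounded measurable `ρ₀` and every level `K`, `∫ dens ρ₀ K dμ_K = ∫ ρ₀ dU₀` against the Haar field at level `0`, i.e.
`Σ_{h ∈ adm K} ∫ eterm ρ₀ K h dμ_K = ∫ ρ₀ dU₀`. [folklore] -/
theorem sum_adm_integral_eterm_labelTower (A₁ : ℝ) (hζu : IsZetaUnity F N ν M ζ) (hζ : IsZetaAbsLeOne F N ν M ζ)
    (hω : ∀ (k : ℕ) (s : SeqOfRecord F ν M g p.K k) (t : LbOfRecord F ν p g k),
      Measurable fun z : cfgOfRecord F N p.K (k + 1) × cfgOfRecord F N p.K k => ωOfRecord F N ν M p g k A₁ ζ s t z.2 z.1)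
    {ρ₀ : cfgOfRecord F N p.K 0 → ℝ} (hρ : (bddMeas (cfgOfRecord F N p.K 0)).Gd ρ₀) (K : ℕ) :
    ∑ h ∈ (labelTowerOfRecord F N ν M p g A₁ ζ).adm K,
        ∫ V, (labelTowerOfRecord F N ν M p g A₁ ζ).eterm ρ₀ K h V ∂(lawOfRecord F N p.K K) =
      ∫ U, ρ₀ U ∂(fieldMeasure (F.P p.K) 0 (SU N)) := by
  rw [← integral_finsetSum _ fun h _ => integrable_eterm F N ν M p g hρ K h, ← lawOfRecord_zero F N p.K]
  exact (labelTowerOfRecord F N ν M p g A₁ ζ).integral_dens_eq_of_lt (lawOfRecord F N p.K) ρ₀ K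
    (fun j h _ _ => integrable_eterm F N ν M p g hρ j h) (fun j h q _ _ _ => integrable_op_eterm F N ν M p g hρ j h q)
    (fun j h _ _ => hpres_labelTower_eterm F N ν M p g A₁ hζu hζ hω hρ j h)

end Laws

/-! ## §2 The class weight bound on the concrete tower -/

section ClassWeight

open Classical in
/-- ★★★ **THE (α)-ROAD's CLASS WEIGHT BOUND ON BAŁABAN's LABEL TOWER OF RECORD, KEYS ROOTED AT THE FIRST STEP.**  With the `δ₀ > 0`, `C ≥ 0` of n20-d's
cells Peierls bound (functions of `N`, `L` only): on every torus `F.P K` (`K ≥ 1`), for `g₀⁻² ≥ 4N`, every `E₀`, `A₁`, every residual fluctuation factor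
`ζ` obeying the two displayed laws `IsZetaUnity`, `IsZetaAbsLeOne` whose label weights are (O4)-jointly measurable, every finite family `D` of χ₁-cubes
with regularity letters on pairwise disjoint regions `R c` of at most `m ≥ 1` plaquettes and `ε″ ≥ 0`; for every cutoff `Kc + 1` and every label-family
pattern `E` whose level-`0` families pin `D` into the new large-field family (`t ∈ E 0 h → D ⊆ P(t)`):
`Σ_{h ∈ admS (labelTowerOfRecord A₁ ζ) (labelPattern E) (Kc+1)} ∫ eterm ρ₀ (Kc+1) h dμ_{Kc+1} ≤ (m·e^{Cδ₀ − δ₀g₀⁻²ε″²∕(2N)})^{#D} · ∫ ρ₀ dU₀`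
— module 25's `sum_admS_integral_le_of_record_rootedAtZero` AT MODULE 27's OBJECTS, every tower row a theorem: THE HISTORIES OF THE LABEL TOWER WHOSE
FIRST LABEL PINS `D` LARGE WEIGH, AT ANY LATER LEVEL, AT MOST ONE PEIERLS FACTOR PER PINNED CUBE TIMES THE WHOLE. [folklore] -/
theorem sum_admS_integral_le_labelTower_rootedAtZero :
    ∃ δ₀ : ℝ, 0 < δ₀ ∧ ∃ C : ℝ, 0 ≤ C ∧ ∀ (_hK : 1 ≤ p.K) (g₀ E₀ : ℝ), 4 * N ≤ g₀⁻¹ ^ 2 →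
      ∀ (A₁ : ℝ) {ζ : ZetaOfRecord F N ν M}, IsZetaUnity F N ν M ζ → IsZetaAbsLeOne F N ν M ζ →
      (∀ (k : ℕ) (s : SeqOfRecord F ν M g p.K k) (t : LbOfRecord F ν p g k),
        Measurable fun z : cfgOfRecord F N p.K (k + 1) × cfgOfRecord F N p.K k => ωOfRecord F N ν M p g k A₁ ζ s t z.2 z.1) →
      ∀ (D : Finset (Iχ F ν p g 0)) (R : Iχ F ν p g 0 → Finset (Plaq (F.P p.K) 1)) (m : ℕ) (ε'' : ℝ), 0 ≤ ε'' → 1 ≤ m →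
        (∀ c ∈ D, (R c).card ≤ m) → (∀ c₁ ∈ D, ∀ c₂ ∈ D, c₁ ≠ c₂ → Disjoint (R c₁) (R c₂)) →
        (∀ c ∈ D, ∀ V' : GaugeField (F.P p.K) 1 (SU N),
          (∀ p' ∈ R c, dist1 (GaugeField.plaqHol V' p') < ε'') → chiFactor F N ν p g 0 c V' = 1) →
      ∀ (Kc : ℕ) (E : (j : ℕ) → (Fin j → LabelPat F ν p g) → Finset (LbOfRecord F ν p g j)), (∀ h t, t ∈ E 0 h → D ⊆ t.1) →
        ∑ h ∈ admS (labelTowerOfRecord F N ν M p g A₁ ζ) (labelPattern F ν p g E) (Kc + 1),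
            ∫ x, (labelTowerOfRecord F N ν M p g A₁ ζ).eterm (rhoZeroOfRecord F N p.K g₀ E₀) (Kc + 1) h x ∂(lawOfRecord F N p.K (Kc + 1)) ≤
          ((m : ℝ) * Real.exp (C * δ₀ - δ₀ * g₀⁻¹ ^ 2 * (ε'' ^ 2 / (2 * (Fintype.card (Fin N) : ℝ))))) ^ D.card *
            ∫ x, rhoZeroOfRecord F N p.K g₀ E₀ x ∂(fieldMeasure (F.P p.K) 0 (SU N)) := by
  obtain ⟨δ₀, hδ₀, C, hC, h25⟩ := sum_admS_integral_le_of_record_rootedAtZero F N ν M p g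
  refine ⟨δ₀, hδ₀, C, hC, fun hK g₀ E₀ hg A₁ ζ hζu hζ hω D R m ε'' hε hm1 hm hdisj hreg Kc E hE0 => ?_⟩
  have key := h25 hK g₀ E₀ hg A₁ hζu hζ (zeta_nonneg_of_laws F N ν M hζu hζ) (Seq.zero (DOfRecord F ν M g p.K)) D R m ε'' hε hm1 hm
    hdisj hreg Kc (labelTowerOfRecord F N ν M p g A₁ ζ) (labelPattern F ν p g E) (lawOfRecord F N p.K) (labelChi F N ν M p g A₁ ζ)
    (seqOfHist F ν M p g) E rfl hE0 (lawOfRecord_zero F N p.K) (hread_labelTower F N ν M p g A₁ hζu hζ E)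
    (fun j h _ _ q _ f hf => hstep_labelTower F N ν M p g hω j h q f hf)
    (fun j h _ _ q _ => integrable_labelChi_mul_eterm F N ν M p g hω (rhoZeroOfRecord_good F N p.K g₀ E₀) j h q)
    (fun j h _ _ _ => integrable_eterm F N ν M p g (rhoZeroOfRecord_good F N p.K g₀ E₀) j h) (rhoZeroOfRecord_good F N p.K g₀ E₀)
  rwa [lawOfRecord_zero] at key

open Classical in
/-- ★ **THE RELATIVE FORM — END2's `extractA` SHAPE VERBATIM** («the partial sum of the weights over the class is at most `q` times the full sum»,
`Support/B16HistoryTowerExtractionPricedDataLWR.extractA`, here `q = (m·r)^{#D}`): with the binders of `sum_admS_integral_le_labelTower_rootedAtZero`,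
`Σ_{h ∈ admS … (Kc+1)} ∫ eterm ρ₀ (Kc+1) h dμ_{Kc+1} ≤ (m·e^{Cδ₀ − δ₀g₀⁻²ε″²∕(2N)})^{#D} · Σ_{h ∈ adm (Kc+1)} ∫ eterm ρ₀ (Kc+1) h dμ_{Kc+1}` — the full sum
being the level-`0` mass by `sum_adm_integral_eterm_labelTower`. [folklore] -/
theorem sum_admS_integral_le_mul_sum_adm_labelTower_rootedAtZero :
    ∃ δ₀ : ℝ, 0 < δ₀ ∧ ∃ C : ℝ, 0 ≤ C ∧ ∀ (_hK : 1 ≤ p.K) (g₀ E₀ : ℝ), 4 * N ≤ g₀⁻¹ ^ 2 →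
      ∀ (A₁ : ℝ) {ζ : ZetaOfRecord F N ν M}, IsZetaUnity F N ν M ζ → IsZetaAbsLeOne F N ν M ζ →
      (∀ (k : ℕ) (s : SeqOfRecord F ν M g p.K k) (t : LbOfRecord F ν p g k),
        Measurable fun z : cfgOfRecord F N p.K (k + 1) × cfgOfRecord F N p.K k => ωOfRecord F N ν M p g k A₁ ζ s t z.2 z.1) →
      ∀ (D : Finset (Iχ F ν p g 0)) (R : Iχ F ν p g 0 → Finset (Plaq (F.P p.K) 1)) (m : ℕ) (ε'' : ℝ), 0 ≤ ε'' → 1 ≤ m →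
        (∀ c ∈ D, (R c).card ≤ m) → (∀ c₁ ∈ D, ∀ c₂ ∈ D, c₁ ≠ c₂ → Disjoint (R c₁) (R c₂)) →
        (∀ c ∈ D, ∀ V' : GaugeField (F.P p.K) 1 (SU N),
          (∀ p' ∈ R c, dist1 (GaugeField.plaqHol V' p') < ε'') → chiFactor F N ν p g 0 c V' = 1) →
      ∀ (Kc : ℕ) (E : (j : ℕ) → (Fin j → LabelPat F ν p g) → Finset (LbOfRecord F ν p g j)), (∀ h t, t ∈ E 0 h → D ⊆ t.1) →
        ∑ h ∈ admS (labelTowerOfRecord F N ν M p g A₁ ζ) (labelPattern F ν p g E) (Kc + 1),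
            ∫ x, (labelTowerOfRecord F N ν M p g A₁ ζ).eterm (rhoZeroOfRecord F N p.K g₀ E₀) (Kc + 1) h x ∂(lawOfRecord F N p.K (Kc + 1)) ≤
          ((m : ℝ) * Real.exp (C * δ₀ - δ₀ * g₀⁻¹ ^ 2 * (ε'' ^ 2 / (2 * (Fintype.card (Fin N) : ℝ))))) ^ D.card *
            ∑ h ∈ (labelTowerOfRecord F N ν M p g A₁ ζ).adm (Kc + 1),
              ∫ x, (labelTowerOfRecord F N ν M p g A₁ ζ).eterm (rhoZeroOfRecord F N p.K g₀ E₀) (Kc + 1) h x ∂(lawOfRecord F N p.K (Kc + 1)) := by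
  obtain ⟨δ₀, hδ₀, C, hC, h⟩ := sum_admS_integral_le_labelTower_rootedAtZero F N ν M p g
  refine ⟨δ₀, hδ₀, C, hC, fun hK g₀ E₀ hg A₁ ζ hζu hζ hω D R m ε'' hε hm1 hm hdisj hreg Kc E hE0 => ?_⟩
  rw [sum_adm_integral_eterm_labelTower F N ν M p g A₁ hζu hζ hω (rhoZeroOfRecord_good F N p.K g₀ E₀) (Kc + 1)]
  exact h hK g₀ E₀ hg A₁ hζu hζ hω D R m ε'' hε hm1 hm hdisj hreg Kc E hE0

end ClassWeight

/-! ## §3 The two named Props of the road, jointly inhabited on the concrete tower -/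

section Halves

open Classical in
/-- **`PointwiseExtraction ∧ LocCondStability` ON BAŁABAN's LABEL TOWER OF RECORD, AT EVERY CUTOFF, KEYS ROOTED AT THE FIRST STEP** (module 24's
`halves_of_record_rootedAtZero` at module 27's objects — the road's `hstep`-kernels ARE the tower's `labelChi`, its rows `hread` ∕ `hint` ∕ `hρ₀` ∕
`μ 0 = Haar` ∕ `0 ≤ ζ` theorems): with the residual binders of §2, for every cutoff `Kc`, every label-family pattern `E` pinning `D` at level `0`, every
carrier family with `Mc 0 h = e^{a 0 h}·𝟙[∀ c ∈ D, ∃ p′ ∈ R c, ε″ ≤ |Ū(∂p′) − 1|]`, `Mc j h = 1` (`j ≥ 1`), and exponents with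
`e^{a 0 h}·(m·r)^{#D} ≤ e^{b 0 h}`, `a j h ≤ 0 ≤ b j h` (`j ≥ 1`), BOTH NAMED `Prop`s of `Spine/NE7b/LocalConditionalStability` hold for the label tower in
the state `ρ₀` under the laws of record (no (O4) measurability needed for the halves themselves — it enters `hstep`, §2). [folklore] -/
theorem halves_labelTower_rootedAtZero :
    ∃ δ₀ : ℝ, 0 < δ₀ ∧ ∃ C : ℝ, 0 ≤ C ∧ ∀ (_hK : 1 ≤ p.K) (g₀ E₀ : ℝ), 4 * N ≤ g₀⁻¹ ^ 2 →
      ∀ (A₁ : ℝ) {ζ : ZetaOfRecord F N ν M}, IsZetaUnity F N ν M ζ → IsZetaAbsLeOne F N ν M ζ →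
      ∀ (D : Finset (Iχ F ν p g 0)) (R : Iχ F ν p g 0 → Finset (Plaq (F.P p.K) 1)) (m : ℕ) (ε'' : ℝ), 0 ≤ ε'' →
        (∀ c ∈ D, (R c).card ≤ m) → (∀ c₁ ∈ D, ∀ c₂ ∈ D, c₁ ≠ c₂ → Disjoint (R c₁) (R c₂)) →
        (∀ c ∈ D, ∀ V' : GaugeField (F.P p.K) 1 (SU N),
          (∀ p' ∈ R c, dist1 (GaugeField.plaqHol V' p') < ε'') → chiFactor F N ν p g 0 c V' = 1) →
      ∀ (Kc : ℕ) (E : (j : ℕ) → (Fin j → LabelPat F ν p g) → Finset (LbOfRecord F ν p g j))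
        (Mc : (j : ℕ) → (Fin j → LabelPat F ν p g) → cfgOfRecord F N p.K j → ℝ) (a b : (j : ℕ) → (Fin j → LabelPat F ν p g) → ℝ),
        (∀ h t, t ∈ E 0 h → D ⊆ t.1) →
        (∀ (h : Fin 0 → LabelPat F ν p g) (U : cfgOfRecord F N p.K 0), Mc 0 h U = Real.exp (a 0 h) *
          Set.indicator {U : GaugeField (F.P p.K) 0 (SU N) |
            ∀ c ∈ D, ∃ p' ∈ R c, ε'' ≤ dist1 (GaugeField.plaqHol ((avOfRecord F N p.K 0).avg U) p')} (fun _ => (1 : ℝ)) U) →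
        (∀ (j : ℕ) (h : Fin j → LabelPat F ν p g), 1 ≤ j → Mc j h = fun _ => 1) →
        (∀ h : Fin 0 → LabelPat F ν p g, Real.exp (a 0 h) *
          ((m : ℝ) * Real.exp (C * δ₀ - δ₀ * g₀⁻¹ ^ 2 * (ε'' ^ 2 / (2 * (Fintype.card (Fin N) : ℝ))))) ^ D.card ≤
            Real.exp (b 0 h)) →
        (∀ (j : ℕ) (h : Fin j → LabelPat F ν p g), 1 ≤ j → a j h ≤ 0 ∧ 0 ≤ b j h) →
        PointwiseExtraction (labelTowerOfRecord F N ν M p g A₁ ζ) (labelPattern F ν p g E) Kc (labelChi F N ν M p g A₁ ζ) Mc a ∧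
          LocCondStability (labelTowerOfRecord F N ν M p g A₁ ζ) (labelPattern F ν p g E) Kc (lawOfRecord F N p.K)
            (rhoZeroOfRecord F N p.K g₀ E₀) Mc b := by
  obtain ⟨δ₀, hδ₀, C, hC, h24⟩ := halves_of_record_rootedAtZero F N ν M p g
  refine ⟨δ₀, hδ₀, C, hC, fun hK g₀ E₀ hg A₁ ζ hζu hζ D R m ε'' hε hm hdisj hreg Kc E Mc a b hE0 hM0 hMj hb0 habj => ?_⟩
  exact h24 hK g₀ E₀ hg A₁ hζu hζ (zeta_nonneg_of_laws F N ν M hζu hζ) (Seq.zero (DOfRecord F ν M g p.K)) D R m ε'' hε hm hdisj hreg Kc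
    (labelTowerOfRecord F N ν M p g A₁ ζ) (labelPattern F ν p g E) (lawOfRecord F N p.K) (labelChi F N ν M p g A₁ ζ) Mc a b
    (seqOfHist F ν M p g) E rfl hE0 (lawOfRecord_zero F N p.K) (hread_labelTower F N ν M p g A₁ hζu hζ E) hM0 hMj hb0 habj
    (fun j h _ _ _ => integrable_eterm F N ν M p g (rhoZeroOfRecord_good F N p.K g₀ E₀) j h) (rhoZeroOfRecord_good F N p.K g₀ E₀)

end Halves

/-! ## §4 (v1.1, append-only) Overlapping letter regions: one Peierls factor per `K₀` pinned cubes -/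

section Overlap

open Summit.QuantumFields.YangMills.BalabanUVNodes.N20LCSLargeFieldSparsify (exists_disjoint_subfamily)

open Classical in
/-- ★ **THE CLASS WEIGHT BOUND WITH OVERLAPPING LETTER REGIONS.**  As `sum_admS_integral_le_labelTower_rootedAtZero`, but the regions `R □` (`□ ∈ D`) need
not be pairwise disjoint: if each meets at most `K₀ ≥ 1` regions of the family, there is an exponent `n` with `#D ≤ K₀·n` such that the class of label
histories whose first label pins `D` weighs at most `(m·e^{Cδ₀ − δ₀g₀⁻²ε″²∕(2N)})^{n}` times the level-`0` mass — module 26's greedy sparsification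
(`exists_disjoint_subfamily`) followed by §2 on the disjoint sub-family (a pattern pinning `D` pins every sub-family of `D`). [folklore] -/
theorem sum_admS_integral_le_labelTower_rootedAtZero_of_overlap :
    ∃ δ₀ : ℝ, 0 < δ₀ ∧ ∃ C : ℝ, 0 ≤ C ∧ ∀ (_hK : 1 ≤ p.K) (g₀ E₀ : ℝ), 4 * N ≤ g₀⁻¹ ^ 2 →
      ∀ (A₁ : ℝ) {ζ : ZetaOfRecord F N ν M}, IsZetaUnity F N ν M ζ → IsZetaAbsLeOne F N ν M ζ →
      (∀ (k : ℕ) (s : SeqOfRecord F ν M g p.K k) (t : LbOfRecord F ν p g k),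
        Measurable fun z : cfgOfRecord F N p.K (k + 1) × cfgOfRecord F N p.K k => ωOfRecord F N ν M p g k A₁ ζ s t z.2 z.1) →
      ∀ (D : Finset (Iχ F ν p g 0)) (R : Iχ F ν p g 0 → Finset (Plaq (F.P p.K) 1)) (m : ℕ) (ε'' : ℝ), 0 ≤ ε'' → 1 ≤ m →
        (∀ c ∈ D, (R c).card ≤ m) → ∀ (K₀ : ℕ), 1 ≤ K₀ → (∀ c ∈ D, (D.filter fun c' => ¬ Disjoint (R c) (R c')).card ≤ K₀) →
        (∀ c ∈ D, ∀ V' : GaugeField (F.P p.K) 1 (SU N),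
          (∀ p' ∈ R c, dist1 (GaugeField.plaqHol V' p') < ε'') → chiFactor F N ν p g 0 c V' = 1) →
      ∀ (Kc : ℕ) (E : (j : ℕ) → (Fin j → LabelPat F ν p g) → Finset (LbOfRecord F ν p g j)), (∀ h t, t ∈ E 0 h → D ⊆ t.1) →
        ∃ n : ℕ, D.card ≤ K₀ * n ∧
          ∑ h ∈ admS (labelTowerOfRecord F N ν M p g A₁ ζ) (labelPattern F ν p g E) (Kc + 1),
              ∫ x, (labelTowerOfRecord F N ν M p g A₁ ζ).eterm (rhoZeroOfRecord F N p.K g₀ E₀) (Kc + 1) h x ∂(lawOfRecord F N p.K (Kc + 1)) ≤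
            ((m : ℝ) * Real.exp (C * δ₀ - δ₀ * g₀⁻¹ ^ 2 * (ε'' ^ 2 / (2 * (Fintype.card (Fin N) : ℝ))))) ^ n *
              ∫ x, rhoZeroOfRecord F N p.K g₀ E₀ x ∂(fieldMeasure (F.P p.K) 0 (SU N)) := by
  obtain ⟨δ₀, hδ₀, C, hC, h⟩ := sum_admS_integral_le_labelTower_rootedAtZero F N ν M p g
  refine ⟨δ₀, hδ₀, C, hC, fun hK g₀ E₀ hg A₁ ζ hζu hζ hω D R m ε'' hε hm1 hm K₀ hK₀ hover hreg Kc E hE0 => ?_⟩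
  obtain ⟨D', hD'D, hdisj', hcard⟩ := exists_disjoint_subfamily R hK₀ D hover
  refine ⟨D'.card, hcard, ?_⟩
  exact h hK g₀ E₀ hg A₁ hζu hζ hω D' R m ε'' hε hm1 (fun c hc => hm c (hD'D hc)) hdisj' (fun c hc => hreg c (hD'D hc)) Kc E
    (fun h' t ht => (Finset.Subset.trans hD'D (hE0 h' t ht)))

end Overlap

end Summit.QuantumFields.YangMills.BalabanUVNodes.N20LCSLabelTowerClassWeight

end
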